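import Summits.QuantumFields.BalabanUV.T4Continuum.Support.VariationalVectorGaugeSliceTower
import Summits.QuantumFields.BalabanUV.T4Continuum.Support.VariationalVectorOneStepFlat

/-!
# T⁴ programme, spine node NE2 (U1a), lane P2 — THE TWO LOCALISED `G`-BINDERS OF `VariationalAssemblySliceMin` AT FLAT DATA, EVERY LEVEL:
# (SLICE-min) (trivially, σ = σ′ = 0) and (ONE-min) = leaf V-ONE INTO THE COMPOSITE FIBRE with Bałaban's gauge functional, `δ′ = 0` (model level; cell `pub-balaban`)

NE2 formalisation swarm `b2b-balaban-t4-ne2-formalise-*`, leaf prover 01 GEN 7 (`prover-b2b-balaban-t4-ne2-formalise-leaf-01-g7-0`); item «V-GF WITH BACKGROUND», step 3 (journal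
2026-08-20 ≈16:0xZ).  Pure composition of tree theorems BY NAME: leaf-09-g7's `VariationalVectorGaugeSliceFlat.slice_flat` (p222324: the zero-cost gauge move to
`{projG 1 (ker Q′_1) = 0}` inside every fibre of the flat line average, curl form unchanged) and `VariationalVectorGaugeSliceTower` (p222627: `Gk`, `Gk′ = projGf`, `Gtr_projGf`,
`QvL_comp_flat`, `hslice_tower`), leaf-10-g3's transports `VariationalVectorTower.SfV_eq_transport` ∕ `comp_symm_comp` (p218948), and leaf-01-g6's flat V-ONE competitor
`VariationalVectorOneStepFlat.exists_oneStep_vector_flat` (p220658: the tilted interpolant meets the (1.18) constraint EXACTLY, pure-curl fine form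
`≤ ScV 1 G W + 4(d+26)(L∕n²)·rhoV W`).

WHY.  `VariationalAssemblySliceMin.pair_bracket_sqrt_min` (this seat, step 2) replaces the slice END's two `G`-binders by their localised forms: (SLICE-min) at averaged fine
minimisers and (ONE-min) «at a coarse minimiser `W₀` there is SOME field of the COMPOSITE fibre whose FULL fine form is `≤ (√(Sc W₀ + ε₁ρ W₀) + δ′√(qW W₀))²`».  leaf-09-g7's located
remark (CLAIMS.log 2026-08-20 15:26Z (3)) showed that the ONE-STEP-fibre version (`hONE` for the full fine form, p221732's socket) has no inhabitant at `U = 1` from the landed files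
(the fine slice is not reachable inside a one-step fibre once `k ≥ 1`); the COMPOSITE-fibre version IS inhabited, by exactly two landed theorems: take leaf-01-g6's flat competitor `W′`
(`QvV W′ = W₀`, pure-curl fine form bounded), transport it to level `L^{k+1}` along `sites`, apply `slice_flat` THERE (composite fibre = the level-`L^{k+1}` fibre by `QvL_comp_flat`; curl
unchanged; `projG = 0`), transport back.  Hence at flat data, for `G k := Gk L M k = projG 1 (ker Q′_1)` and `G′ k := Gk′ L M k`:
 * **`hsliceMin_tower`** — (SLICE-min) with `σ = σ′ = 0` at every level (from `hslice_tower`; the minimality hypothesis is not even used);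
 * **`hONEm_tower`** — (ONE-min) with `ε₁ k = 4(d+26)·L∕(L^k)²`, `ρV k = rhoV (L^k) M 1`, `δ′ k = 0` at every level (the minimality hypothesis is not used either: the competitor exists
   for EVERY coarse field).
So in an END built on `pair_bracket_sqrt_min` the V-ONE socket is DISCHARGED at flat data by landed files, with decay `ε₁ k ≤ 4(d+26)L·(L⁻²)^k`, `δ′ k = 0` — what remains displayed
there is V-REG (`hREG`, leaf-03-g5's line) and the uniform `C_R`.  (This file does not touch leaf-10-g3's `VariationalVectorEndFlat`, which is built on p221732's sockets.)

HONEST FRAMING (T4-DAG p. 1).  Flat data = free field, `E = ℂ`; [folklore] composition; nothing printed is a hypothesis; no `def`, no `def … : Prop`, no `sorry`; axioms standard.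
Nothing with background is discharged (memo `t4/T4-EST-NE2-P2-VGF.md`); V-END ∕ NE2 NOT proved; NE3 OPEN; spine PROVED 0∕9 unchanged; rung (B)+1 finite T⁴ — NOT infinite volume,
NOT mass gap, NOT Clay.  HONEST DEPENDENCY (cell, verbatim): continuum YM on T⁴ ⇐ BetaPertH ∧ nine spine estimates (0/9 proved); BetaPertH ⇐ (D1) ∧ (D4) ∧ CAP+tail; G-an2-4
gates asym, D1 and NE2/3/4.
-/

noncomputable section

namespace Summit.QuantumFields.BalabanUV.T4Continuum.VariationalAssemblySliceMinFlat

open Literature.MathematicalPhysics.QuantumFieldTheory.Balaban1983to89.B5Prop11Plancherel (Tor fine unitVec)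
open Literature.MathematicalPhysics.QuantumFieldTheory.Balaban1983to89.B5Composition116 (sites)
open Summit.QuantumFields.BalabanUV.T4Continuum.VariationalVectorForm (curlSq ScV SfV qWV ScV_nonneg)
open Summit.QuantumFields.BalabanUV.T4Continuum.VectorBlockTrialForm (QvL QvV nsqV)
open Summit.QuantumFields.BalabanUV.T4Continuum.VariationalColourTower (Rtrv)
open Summit.QuantumFields.BalabanUV.T4Continuum.VariationalVectorTower (Gtr SfV_eq_transport comp_symm_comp)
open Summit.QuantumFields.BalabanUV.T4Continuum.VariationalVectorGaugeSlice (projG projG_nonneg lineT_flat)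
open Summit.QuantumFields.BalabanUV.T4Continuum.VariationalVectorGaugeSliceFlat (kerAvgFlat slice_flat)
open Summit.QuantumFields.BalabanUV.T4Continuum.VariationalVectorGaugeSliceB5 (flatR)
open Summit.QuantumFields.BalabanUV.T4Continuum.VariationalVectorGaugeSliceTower (Gk Gk' projGf Gtr_projGf Rtrv_flat QvL_comp_flat hslice_tower)
open Summit.QuantumFields.BalabanUV.T4Continuum.VariationalVectorOneStepFlat (exists_oneStep_vector_flat QvL_one_eq_QvV)
open Summit.QuantumFields.BalabanUV.T4Continuum.VariationalVectorOneStepPhys (rhoV rhoV_nonneg)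

variable {d : ℕ} (L : ℕ) [NeZero L] (M : Fin d → ℕ) [hM : ∀ μ, NeZero (M μ)]

/-- **(SLICE-min) AT FLAT DATA, EVERY LEVEL, σ = σ′ = 0** — the `hslice` socket of `VariationalAssemblySliceMin.vector_pair_bracket_sqrt_min_line` at `R = 1`, `T′ = 1`,
`Qk :=` the flat line average, `G := Gk L M k`: from leaf-09-g7's `hslice_tower` applied at the averaged field (the minimality hypothesis is not needed). [folklore] -/
theorem hsliceMin_tower (k : ℕ) (φ : Tor M → Fin d → ℂ) (g₀ : Tor (fine L (fine (L ^ k) M)) → Fin d → ℂ)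
    (hg₀ : QvL (L ^ k) M (fun _ _ _ _ => (1 : ℂ →L[ℂ] ℂ)) (QvL L (fine (L ^ k) M) (fun _ _ _ _ => (1 : ℂ →L[ℂ] ℂ)) g₀) = φ)
    (_hmin : ∀ W' : Tor (fine L (fine (L ^ k) M)) → Fin d → ℂ,
      QvL (L ^ k) M (fun _ _ _ _ => (1 : ℂ →L[ℂ] ℂ)) (QvL L (fine (L ^ k) M) (fun _ _ _ _ => (1 : ℂ →L[ℂ] ℂ)) W') = φ →
      SfV (L ^ k) L M (flatR L (fine (L ^ k) M)) (Gk' L M k) g₀ ≤ SfV (L ^ k) L M (flatR L (fine (L ^ k) M)) (Gk' L M k) W') :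
    ∃ Ws : Tor (fine (L ^ k) M) → Fin d → ℂ, QvL (L ^ k) M (fun _ _ _ _ => (1 : ℂ →L[ℂ] ℂ)) Ws = φ ∧
      ScV (L ^ k) M (flatR (L ^ k) M) (Gk L M k) Ws
        ≤ ScV (L ^ k) M (flatR (L ^ k) M) (fun _ => 0) (QvL L (fine (L ^ k) M) (fun _ _ _ _ => (1 : ℂ →L[ℂ] ℂ)) g₀)
          + 0 * ScV (L ^ k) M (flatR (L ^ k) M) (fun _ => 0) (QvL L (fine (L ^ k) M) (fun _ _ _ _ => (1 : ℂ →L[ℂ] ℂ)) g₀)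
          + 0 * qWV (L ^ k) M (QvL L (fine (L ^ k) M) (fun _ _ _ _ => (1 : ℂ →L[ℂ] ℂ)) g₀) := by
  obtain ⟨Ws, hQ, hS⟩ := hslice_tower L M k (QvL L (fine (L ^ k) M) (fun _ _ _ _ => (1 : ℂ →L[ℂ] ℂ)) g₀)
  exact ⟨Ws, hQ.trans hg₀, hS⟩

/-- **(ONE-min) AT FLAT DATA, EVERY LEVEL — leaf V-ONE INTO THE COMPOSITE FIBRE WITH BAŁABAN's GAUGE FUNCTIONAL, `δ′ = 0`**: for every coarse field `W₀` (a fortiori for the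
coarse minimiser) there is a fine field `g` with composite flat average `Q_{L^k}(Q_L g) = Q_{L^k} W₀` and FULL fine form
`SfV (L^k) L M 1 (Gk′ k) g ≤ (√(ScV (L^k) M 1 (Gk k) W₀ + 4(d+26)(L∕(L^k)²)·rhoV W₀) + 0·√(qWV W₀))²` — leaf-01-g6's flat competitor (p220658) transported to level `L^{k+1}`,
moved onto the slice there at zero cost (leaf-09-g7's `slice_flat`, p222324), transported back. [folklore] -/
theorem hONEm_tower (k : ℕ) (φ : Tor M → Fin d → ℂ) (W₀ : Tor (fine (L ^ k) M) → Fin d → ℂ)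
    (hW₀ : QvL (L ^ k) M (fun _ _ _ _ => (1 : ℂ →L[ℂ] ℂ)) W₀ = φ)
    (_hmin : ∀ W : Tor (fine (L ^ k) M) → Fin d → ℂ, QvL (L ^ k) M (fun _ _ _ _ => (1 : ℂ →L[ℂ] ℂ)) W = φ →
      ScV (L ^ k) M (flatR (L ^ k) M) (Gk L M k) W₀ ≤ ScV (L ^ k) M (flatR (L ^ k) M) (Gk L M k) W) :
    ∃ g : Tor (fine L (fine (L ^ k) M)) → Fin d → ℂ,
      QvL (L ^ k) M (fun _ _ _ _ => (1 : ℂ →L[ℂ] ℂ)) (QvL L (fine (L ^ k) M) (fun _ _ _ _ => (1 : ℂ →L[ℂ] ℂ)) g) = φ ∧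
      SfV (L ^ k) L M (flatR L (fine (L ^ k) M)) (Gk' L M k) g
        ≤ (Real.sqrt (ScV (L ^ k) M (flatR (L ^ k) M) (Gk L M k) W₀
              + 4 * ((d : ℝ) + 26) * ((L : ℝ) / ((L ^ k : ℕ) : ℝ) ^ 2) * rhoV (L ^ k) M (flatR (L ^ k) M) W₀)
            + 0 * Real.sqrt (qWV (L ^ k) M W₀)) ^ 2 := by
  -- leaf-01-g6's flat one-step competitor for `W₀` with `G := Gk k`
  obtain ⟨W', hQ', hS'⟩ := exists_oneStep_vector_flat (L ^ k) L M (E := ℂ) (G := Gk L M k) (fun W => projG_nonneg _ _ _ W) W₀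
  -- the zero-cost slice move at level `L^k·L`, in `sites` coordinates
  obtain ⟨Ws, hQs, hcurl, hG⟩ := slice_flat (L ^ k * L) M (W' ∘ sites (L ^ k) L M)
  rw [lineT_flat] at hQs
  have hQ'' : QvL L (fine (L ^ k) M) (fun _ _ _ _ => (1 : ℂ →L[ℂ] ℂ)) W' = W₀ := by rw [QvL_one_eq_QvV]; exact hQ'
  refine ⟨Ws ∘ (sites (L ^ k) L M).symm, ?_, ?_⟩
  · -- the composite flat average of the moved field is that of `W′`, i.e. `Q_{L^k} W₀ = φ`
    rw [QvL_comp_flat, comp_symm_comp, hQs, ← QvL_comp_flat, hQ'', hW₀]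
  · -- its FULL fine form is the pure-curl fine form of `W′`
    have hP : 0 ≤ ScV (L ^ k) M (flatR (L ^ k) M) (Gk L M k) W₀
        + 4 * ((d : ℝ) + 26) * ((L : ℝ) / ((L ^ k : ℕ) : ℝ) ^ 2) * rhoV (L ^ k) M (flatR (L ^ k) M) W₀ := by
      have := ScV_nonneg (L ^ k) M (flatR (L ^ k) M) (fun W => projG_nonneg _ _ _ W) W₀ (G := Gk L M k)
      have := rhoV_nonneg (L ^ k) M (flatR (L ^ k) M) W₀
      positivity
    rw [zero_mul, add_zero, Real.sq_sqrt hP]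
    have hform : SfV (L ^ k) L M (flatR L (fine (L ^ k) M)) (Gk' L M k) (Ws ∘ (sites (L ^ k) L M).symm)
        = SfV (L ^ k) L M (flatR L (fine (L ^ k) M)) (fun _ => 0) W' := by
      rw [SfV_eq_transport, SfV_eq_transport, comp_symm_comp, Rtrv_flat]
      unfold Gk'
      rw [Gtr_projGf]
      unfold ScV
      rw [hG, hcurl]
      rfl
    rw [hform]
    exact hS'

end Summit.QuantumFields.BalabanUV.T4Continuum.VariationalAssemblySliceMinFlat

end
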